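import Summits.CriticalPhenomena.PercolationContinuityZ3.Theorems.PercNearOneGluingNoHeavyLowerTailIncStarTwoCutFarRows
import Summits.CriticalPhenomena.PercolationContinuityZ3.Theorems.PercNearOneGluingNoHeavyLowerTailIncStarTwoCutFXCert
import Summits.CriticalPhenomena.PercolationContinuityZ3.Theorems.PercNearOneGluingNoHeavyLowerTailIncStarTwoCutFYCert
import HarnessLib

/-!
# MODE B, XX: every row of the (FX) and (FY) certificates is valid (kernel `decide`)

Support file for the Sahi programme (`--supports stmt-CriticalPhenomena-4575`, prover prim-sahi-p2 gen 28).  No sorries, no named facts,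
no `native_decide`.  `fxBlocks_valid` / `fyBlocks_valid`: every row of the certificate data `fxBlocks` (158 rows) / `fyBlocks` (168 rows)
satisfies the decidable validity predicate `FRow.valid` of `…IncStarTwoCutFarRows` (four-events condition `adOK` or a tabulated BHK 1.1
instance for the product rows; Harris or one of the two far stars for the cubic rows) and is well formed (variable indices `< 19`);
`fxTarget_wf` / `fyTarget_wf`: the target monomials are well formed.  Decided by `decide +kernel`, as `FourPointCert.certBlocks_valid`.
-/

namespace Summit.CriticalPhenomena.PercolationContinuityZ3.Theorems

namespace IncStarTwoCut.FXCert

open IncStarTwoCut.FarCert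

/-- Every row of the (FX) certificate is valid and every block well formed. [this work] -/
theorem fxBlocks_valid : (fxBlocks.all fun blk => blk.row.valid && blk.wf) = true := by
  decide +kernel

/-- Every row of the (FY) certificate is valid and every block well formed. [this work] -/
theorem fyBlocks_valid : (fyBlocks.all fun blk => blk.row.valid && blk.wf) = true := by
  decide +kernel

/-- The (FX) target monomials are well formed. [this work] -/
theorem fxTarget_wf : monosWf fxTargetPos = true ∧ monosWf fxTargetNeg = true := by
  constructor <;> decide +kernel

/-- The (FY) target monomials are well formed. [this work] -/
theorem fyTarget_wf : monosWf fyTargetPos = true ∧ monosWf fyTargetNeg = true := by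
  constructor <;> decide +kernel

/-- `fxBlocks_valid` unpacked: validity. [this work] -/
theorem fxBlocks_valid' : ∀ blk ∈ fxBlocks, blk.row.valid = true := by
  have h := fxBlocks_valid
  rw [List.all_eq_true] at h
  intro blk hb; have := h blk hb; rw [Bool.and_eq_true] at this; exact this.1

/-- `fxBlocks_valid` unpacked: well-formedness. [this work] -/
theorem fxBlocks_wf' : ∀ blk ∈ fxBlocks, blk.wf = true := by
  have h := fxBlocks_valid
  rw [List.all_eq_true] at h
  intro blk hb; have := h blk hb; rw [Bool.and_eq_true] at this; exact this.2

/-- `fyBlocks_valid` unpacked: validity. [this work] -/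
theorem fyBlocks_valid' : ∀ blk ∈ fyBlocks, blk.row.valid = true := by
  have h := fyBlocks_valid
  rw [List.all_eq_true] at h
  intro blk hb; have := h blk hb; rw [Bool.and_eq_true] at this; exact this.1

/-- `fyBlocks_valid` unpacked: well-formedness. [this work] -/
theorem fyBlocks_wf' : ∀ blk ∈ fyBlocks, blk.wf = true := by
  have h := fyBlocks_valid
  rw [List.all_eq_true] at h
  intro blk hb; have := h blk hb; rw [Bool.and_eq_true] at this; exact this.2

end IncStarTwoCut.FXCert

end Summit.CriticalPhenomena.PercolationContinuityZ3.Theorems
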